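import Summits.Schanuel.Schanuel.Theorems.SoloInformedAE2EventuallyA
import Summits.Schanuel.Schanuel.Theorems.SoloInformedAE2EventuallyB
import Summits.Schanuel.Schanuel.Theorems.SoloInformedAE1tauEventually

/-!
# Theorem AE₃-2 (η = 0): the explicit hypotheses of `soloA32_gelfond_input` hold eventually

Soloist file (informed mode, seat `solo-Schanuel-informed`, s182).  Pure real-analysis
bookkeeping for the seat's THEOREM AE₃-2 (`paper/AE-note.md` §14), the 3-term-AP form of
THEOREM AE-2: with the SAME parameters as in `SoloInformedAE2EventuallyA/B` — `x = n^μ`,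
`K = ⌊n^{σ-μ}⌋`, `t = ⌊n^τ/2⌋ + 1`, `N = ⌊n^{1-μ+δ}⌋`, `Lg = n^{β-μ+δ}`, `V = n^ν/4` — the
hypotheses of `soloA32_gelfond_input` that differ from the AE-2 ones hold for all large `n`:

* `soloAW_W_compare`: `400 n^{ν'} ≤ n^ν` for `ν' < ν`, in the two shapes used below (the new
  serving radius `W = V K/(160000 N)` is the old one divided by `400`, so most AE-2 lemmas are
  simply invoked at a slightly smaller exponent `ν'`);
* `soloAW_condB` (`hbud`, constant `80000`): from `soloAV_condB`, when `1 + β + μ < σ + τ + ν`;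
* `soloAW_cond4` (`h₄`): `log 4 ≤ V K/(320000 N)` when `0 < ν + σ - 1 - δ`;
* `soloAW_condD` (`h₅`, the budget of the 3-AP rigidity theorem at the root-count scale) — the
  ONE place where the threshold is used, as `2 + β - 3μ + 3δ - 3τ < 3σ - 2μ + ν - 1 - δ`, i.e.
  `ν > 3 + β - 3σ - 3τ - μ + 4δ` (AE-2 needed `ν > 4 + β - 4σ - 4τ - μ + 5δ` here);
* `soloAW_condE` (`h₆`) and `soloAW_condH` (the comparison with Gel'fond's lower bound): from
  `soloAV_condE`, `soloAV_condH` at a smaller exponent.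

Balancing `soloAW_condD` against the transfer condition `1 + β + μ < σ + τ + ν` (`soloAW_condB`)
at `μ → 1 - σ - τ` gives the AE₃-2 threshold `ν > β + 2(1 - σ - τ)` on `2σ + τ > 1` (next file).

What this is NOT.  Elementary inequalities only; nothing here bears on
`Literature.Periods.SchanuelConjecture` (the seat's verdict, no path, is unchanged).
Tree files and Mathlib only; no definitions; axioms the standard three.
-/

namespace Summit.Schanuel.Schanuel.Theorems

open Filter

/-- `400 n^{ν'} ≤ n^ν` eventually (`ν' < ν`), in the two shapes used below:
for the bad-point budget (`K t n^{ν'}/8` against `K t n^ν/8`) and for the serving radius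
(`(n^{ν'}/4) K/(400 N)/2 ≤ (n^ν/4) K/(160000 N)/2`). -/
theorem soloAW_W_compare (σ μ δ τ : ℝ) {ν ν' : ℝ} (h : ν' < ν) :
    ∀ᶠ n : ℕ in atTop,
      400 * (⌊(n : ℝ) ^ (σ - μ)⌋₊ * (((⌊(n : ℝ) ^ τ / 2⌋₊ + 1 : ℕ) : ℝ) * ((n : ℝ) ^ ν' / 8))) ≤
          ⌊(n : ℝ) ^ (σ - μ)⌋₊ * (((⌊(n : ℝ) ^ τ / 2⌋₊ + 1 : ℕ) : ℝ) * ((n : ℝ) ^ ν / 8)) ∧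
        (n : ℝ) ^ ν' / 4 * ⌊(n : ℝ) ^ (σ - μ)⌋₊ / (400 * ⌊(n : ℝ) ^ (1 - μ + δ)⌋₊) / 2 ≤
          (n : ℝ) ^ ν / 4 * ⌊(n : ℝ) ^ (σ - μ)⌋₊ / (160000 * ⌊(n : ℝ) ^ (1 - μ + δ)⌋₊) / 2 := by
  filter_upwards [eventually_ge_atTop 1, eventually_const_mul_rpow_le_rpow h 400] with n hn hc
  have hK0 : (0 : ℝ) ≤ ⌊(n : ℝ) ^ (σ - μ)⌋₊ := Nat.cast_nonneg _
  have hN0 : (0 : ℝ) ≤ ⌊(n : ℝ) ^ (1 - μ + δ)⌋₊ := Nat.cast_nonneg _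
  have ht0 : (0 : ℝ) ≤ (((⌊(n : ℝ) ^ τ / 2⌋₊ + 1 : ℕ) : ℝ)) := Nat.cast_nonneg _
  have base : 400 * ((n : ℝ) ^ ν' * ⌊(n : ℝ) ^ (σ - μ)⌋₊) ≤
      (n : ℝ) ^ ν * ⌊(n : ℝ) ^ (σ - μ)⌋₊ := by
    rw [← mul_assoc]
    exact mul_le_mul_of_nonneg_right hc hK0
  constructor
  · have h1 : 400 * (⌊(n : ℝ) ^ (σ - μ)⌋₊ * (((⌊(n : ℝ) ^ τ / 2⌋₊ + 1 : ℕ) : ℝ) *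
        ((n : ℝ) ^ ν' / 8))) =
        400 * ((n : ℝ) ^ ν' * ⌊(n : ℝ) ^ (σ - μ)⌋₊) * (((⌊(n : ℝ) ^ τ / 2⌋₊ + 1 : ℕ) : ℝ)) /
          8 := by ring
    have h2 : (⌊(n : ℝ) ^ (σ - μ)⌋₊ : ℝ) * ((((⌊(n : ℝ) ^ τ / 2⌋₊ + 1 : ℕ) : ℝ)) *
        ((n : ℝ) ^ ν / 8)) =
        (n : ℝ) ^ ν * ⌊(n : ℝ) ^ (σ - μ)⌋₊ * (((⌊(n : ℝ) ^ τ / 2⌋₊ + 1 : ℕ) : ℝ)) / 8 := by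
      ring
    rw [h1, h2]
    exact div_le_div_of_nonneg_right (mul_le_mul_of_nonneg_right base ht0) (by norm_num)
  · have h1 : (n : ℝ) ^ ν' / 4 * ⌊(n : ℝ) ^ (σ - μ)⌋₊ / (400 * ⌊(n : ℝ) ^ (1 - μ + δ)⌋₊) / 2 =
        400 * ((n : ℝ) ^ ν' * ⌊(n : ℝ) ^ (σ - μ)⌋₊) /
          (1280000 * ⌊(n : ℝ) ^ (1 - μ + δ)⌋₊) := by
      field_simp
      ring
    have h2 : (n : ℝ) ^ ν / 4 * ⌊(n : ℝ) ^ (σ - μ)⌋₊ / (160000 * ⌊(n : ℝ) ^ (1 - μ + δ)⌋₊) / 2 =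
        (n : ℝ) ^ ν * ⌊(n : ℝ) ^ (σ - μ)⌋₊ / (1280000 * ⌊(n : ℝ) ^ (1 - μ + δ)⌋₊) := by
      field_simp
      ring
    rw [h1, h2]
    exact div_le_div_of_nonneg_right base (by positivity)

/-- Hypothesis `hbud` of `soloA32_gelfond_input` (the count of bad points, constant `80000`),
eventually, when `1 + β + μ < σ + τ + ν` (`β > 1`, `0 < μ ≤ 1`). -/
theorem soloAW_condB {β σ τ ν μ : ℝ} (hβ : 1 < β) (hμ0 : 0 < μ) (hμ1 : μ ≤ 1) (hμσ : μ < σ)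
    (hτ0 : 0 ≤ τ) (h : 1 + β + μ < σ + τ + ν) :
    ∀ᶠ n : ℕ in atTop,
      80000 * (10 * (n : ℝ) ^ 2 + 2 * n * (n * Real.log (2 * (n : ℝ) ^ μ) + (n : ℝ) ^ β)) ≤
        ⌊(n : ℝ) ^ (σ - μ)⌋₊ * (((⌊(n : ℝ) ^ τ / 2⌋₊ + 1 : ℕ) : ℝ) * ((n : ℝ) ^ ν / 8)) := by
  set θ : ℝ := (σ + τ + ν - (1 + β + μ)) / 2 with hθ
  have hlt : ν - θ < ν := by rw [hθ]; linarith
  have h' : 1 + β + μ < σ + τ + (ν - θ) := by rw [hθ]; linarith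
  filter_upwards [soloAV_condB hβ hμ0 hμ1 hμσ hτ0 h', soloAW_W_compare σ μ 0 τ hlt]
    with n h1 ⟨ha, _w5⟩
  linarith

/-- Hypothesis `h₄` of `soloA32_gelfond_input`: eventually `log 4 ≤ V K/(320000 N)`,
`V = n^ν/4` (`0 < ν + σ - 1 - δ`). -/
theorem soloAW_cond4 {σ ν μ δ : ℝ} (hμσ : μ < σ) (ha0 : 0 < 1 - μ + δ)
    (hg : 0 < ν + σ - 1 - δ) :
    ∀ᶠ n : ℕ in atTop, Real.log 4 ≤
      (n : ℝ) ^ ν / 4 * ⌊(n : ℝ) ^ (σ - μ)⌋₊ / (320000 * ⌊(n : ℝ) ^ (1 - μ + δ)⌋₊) := by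
  filter_upwards [soloT1_floor (sub_pos.mpr hμσ), soloT1_floor ha0,
    eventually_const_mul_rpow_le_rpow hg (2560000 * Real.log 4)]
    with n ⟨hn1, _w1, _w2, hKge⟩ ⟨_w3, hN1, hNle, _w4⟩ h
  rw [Real.rpow_zero, mul_one] at h
  have hN0 : (0 : ℝ) < ⌊(n : ℝ) ^ (1 - μ + δ)⌋₊ := by
    exact_mod_cast (show 0 < ⌊(n : ℝ) ^ (1 - μ + δ)⌋₊ by omega)
  obtain ⟨hW, -⟩ := soloAV_W_lower (ν := ν) hn1 hKge hN0 hNle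
  have e : (n : ℝ) ^ ν / 4 * ⌊(n : ℝ) ^ (σ - μ)⌋₊ / (320000 * ⌊(n : ℝ) ^ (1 - μ + δ)⌋₊) =
      (n : ℝ) ^ ν / 4 * ⌊(n : ℝ) ^ (σ - μ)⌋₊ / (400 * ⌊(n : ℝ) ^ (1 - μ + δ)⌋₊) / 800 := by
    field_simp
    ring
  rw [e]
  linarith

/-- Hypothesis `h₅` of `soloA32_gelfond_input` (the budget of the 3-AP rigidity theorem at the
root-count scale), eventually — the one place where `ν > 3 + β - 3σ - 3τ - μ + 4δ` is used
(as `2 + β - 3μ + 3δ - 3τ < 3σ - 2μ + ν - 1 - δ`). -/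
theorem soloAW_condD {β σ τ ν μ δ : ℝ} (hβ : 1 ≤ β) (hμσ : μ < σ) (hτ0 : 0 ≤ τ)
    (ha0 : 0 < 1 - μ + δ) (hν : 2 + β - 3 * μ + 3 * δ - 3 * τ < 3 * σ - 2 * μ + ν - 1 - δ) :
    ∀ᶠ n : ℕ in atTop,
      400000 * (3 * ((⌊(n : ℝ) ^ (1 - μ + δ)⌋₊ : ℝ) / ((⌊(n : ℝ) ^ τ / 2⌋₊ + 1 : ℕ) : ℝ)) ^ 2 *
          (((⌊(n : ℝ) ^ (1 - μ + δ)⌋₊ : ℝ) / 2 + (n : ℝ) ^ (β - μ + δ)) /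
            ((⌊(n : ℝ) ^ τ / 2⌋₊ + 1 : ℕ) : ℝ)) +
        2 * ((⌊(n : ℝ) ^ (1 - μ + δ)⌋₊ : ℝ) / ((⌊(n : ℝ) ^ τ / 2⌋₊ + 1 : ℕ) : ℝ)) ^ 3) ≤
      (⌊(n : ℝ) ^ (σ - μ)⌋₊ : ℝ) ^ 2 * ((n : ℝ) ^ ν / 4 * ⌊(n : ℝ) ^ (σ - μ)⌋₊ /
        (160000 * ⌊(n : ℝ) ^ (1 - μ + δ)⌋₊)) := by
  filter_upwards [soloT1_floor (sub_pos.mpr hμσ), soloAV_tfloor hτ0, soloT1_floor ha0,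
    eventually_const_mul_rpow_le_rpow hν (400000 * 52 * 5120000)]
    with n ⟨hn1, hK1, _w8, hKge⟩ ⟨_w9, _w10, htge, _w11⟩ ⟨_w12, hN1, hNle, _w13⟩ hc
  have hn0 : (0 : ℝ) < n := by linarith
  set t : ℝ := ((⌊(n : ℝ) ^ τ / 2⌋₊ + 1 : ℕ) : ℝ) with htdef
  set K : ℝ := (⌊(n : ℝ) ^ (σ - μ)⌋₊ : ℝ) with hKdef
  set N : ℝ := (⌊(n : ℝ) ^ (1 - μ + δ)⌋₊ : ℝ) with hNdef
  have ht0 : 0 < t := by rw [htdef]; positivity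
  have hK0 : 0 < K := by
    rw [hKdef]
    exact_mod_cast (show 0 < ⌊(n : ℝ) ^ (σ - μ)⌋₊ by omega)
  have hN0 : 0 < N := by
    rw [hNdef]
    exact_mod_cast (show 0 < ⌊(n : ℝ) ^ (1 - μ + δ)⌋₊ by omega)
  obtain ⟨hx, hy, -, -⟩ := soloAV_over (τ := τ) hβ hn1 ht0 htge hK0 hKge hNle
  have hx0 : 0 ≤ N / t := by positivity
  -- the left side is at most `400000 · 52 · n^{2+β-3μ+3δ-3τ}`
  have e1 : ((n : ℝ) ^ (1 - μ + δ - τ)) ^ 2 * (n : ℝ) ^ (β - μ + δ - τ) =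
      (n : ℝ) ^ (2 + β - 3 * μ + 3 * δ - 3 * τ) := by
    rw [soloTT_rpow_pow hn0.le, ← Real.rpow_add hn0]
    congr 1
    push_cast
    ring
  have e2 : ((n : ℝ) ^ (1 - μ + δ - τ)) ^ 3 ≤ (n : ℝ) ^ (2 + β - 3 * μ + 3 * δ - 3 * τ) := by
    rw [soloTT_rpow_pow hn0.le]
    exact Real.rpow_le_rpow_of_exponent_le hn1 (by push_cast; linarith)
  have hx2 : (N / t) ^ 2 ≤ (2 * (n : ℝ) ^ (1 - μ + δ - τ)) ^ 2 := pow_le_pow_left₀ hx0 hx 2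
  have hx3 : (N / t) ^ 3 ≤ (2 * (n : ℝ) ^ (1 - μ + δ - τ)) ^ 3 := pow_le_pow_left₀ hx0 hx 3
  have hp1 : 0 ≤ (n : ℝ) ^ (1 - μ + δ - τ) := by positivity
  have hp2 : 0 ≤ (n : ℝ) ^ (β - μ + δ - τ) := by positivity
  have hL : 400000 * (3 * (N / t) ^ 2 * ((N / 2 + (n : ℝ) ^ (β - μ + δ)) / t) +
      2 * (N / t) ^ 3) ≤ 400000 * 52 * (n : ℝ) ^ (2 + β - 3 * μ + 3 * δ - 3 * τ) := by
    have h1 : (N / t) ^ 2 * ((N / 2 + (n : ℝ) ^ (β - μ + δ)) / t) ≤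
        (2 * (n : ℝ) ^ (1 - μ + δ - τ)) ^ 2 * (3 * (n : ℝ) ^ (β - μ + δ - τ)) :=
      mul_le_mul hx2 hy (by positivity) (by positivity)
    have h1' : (2 * (n : ℝ) ^ (1 - μ + δ - τ)) ^ 2 * (3 * (n : ℝ) ^ (β - μ + δ - τ)) =
        12 * (n : ℝ) ^ (2 + β - 3 * μ + 3 * δ - 3 * τ) := by rw [← e1]; ring
    have h2' : (2 * (n : ℝ) ^ (1 - μ + δ - τ)) ^ 3 = 8 * ((n : ℝ) ^ (1 - μ + δ - τ)) ^ 3 := by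
      ring
    nlinarith [h1, h1', h2', hx3, e2]
  -- the right side is at least `n^{3σ-2μ+ν-1-δ} / 5120000`
  have hR : (n : ℝ) ^ (3 * σ - 2 * μ + ν - 1 - δ) / 5120000 ≤
      K ^ 2 * ((n : ℝ) ^ ν / 4 * K / (160000 * N)) := by
    have hK3 : ((n : ℝ) ^ (σ - μ) / 2) ^ 3 ≤ K ^ 3 := pow_le_pow_left₀ (by positivity) hKge 3
    have e3 : (n : ℝ) ^ (3 * σ - 2 * μ + ν - 1 - δ) =
        ((n : ℝ) ^ (σ - μ)) ^ 3 * (n : ℝ) ^ ν / (n : ℝ) ^ (1 - μ + δ) := by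
      rw [soloTT_rpow_pow hn0.le, ← Real.rpow_add hn0, ← Real.rpow_sub hn0]
      congr 1
      push_cast
      ring
    rw [e3]
    have hν0 : 0 ≤ (n : ℝ) ^ ν := by positivity
    have hnum : 0 ≤ K ^ 3 * (n : ℝ) ^ ν := by positivity
    calc ((n : ℝ) ^ (σ - μ)) ^ 3 * (n : ℝ) ^ ν / (n : ℝ) ^ (1 - μ + δ) / 5120000
        = ((n : ℝ) ^ (σ - μ) / 2) ^ 3 * (n : ℝ) ^ ν / (640000 * (n : ℝ) ^ (1 - μ + δ)) := by
          field_simp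
          ring
      _ ≤ K ^ 3 * (n : ℝ) ^ ν / (640000 * (n : ℝ) ^ (1 - μ + δ)) :=
          div_le_div_of_nonneg_right (mul_le_mul_of_nonneg_right hK3 hν0) (by positivity)
      _ ≤ K ^ 3 * (n : ℝ) ^ ν / (640000 * N) :=
          div_le_div_of_nonneg_left hnum (by positivity) (by linarith)
      _ = K ^ 2 * ((n : ℝ) ^ ν / 4 * K / (160000 * N)) := by ring
  linarith [hc]

/-- Hypothesis `h₆` of `soloA32_gelfond_input` (the dilation losses), eventually, when
`1 - τ + δ - μ < ν + σ - 1 - δ` and `β - σ - τ + δ < ν + σ - 1 - δ`. -/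
theorem soloAW_condE (ξ : ℂ) {β σ τ ν μ δ : ℝ} (hβ : 1 ≤ β) (hμσ : μ < σ) (hτ0 : 0 ≤ τ)
    (ha0 : 0 < 1 - μ + δ) (hm1 : 1 - τ + δ - μ < ν + σ - 1 - δ)
    (hm2 : β - σ - τ + δ < ν + σ - 1 - δ) :
    ∀ᶠ n : ℕ in atTop,
      20 * ((⌊(n : ℝ) ^ (1 - μ + δ)⌋₊ : ℝ) / ((⌊(n : ℝ) ^ τ / 2⌋₊ + 1 : ℕ) : ℝ)) /
            ⌊(n : ℝ) ^ (σ - μ)⌋₊ * Real.log (⌊(n : ℝ) ^ (σ - μ)⌋₊ * ‖ξ‖ + 1) +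
        20 * ((((⌊(n : ℝ) ^ (1 - μ + δ)⌋₊ : ℝ) / 2 + (n : ℝ) ^ (β - μ + δ)) /
            ((⌊(n : ℝ) ^ τ / 2⌋₊ + 1 : ℕ) : ℝ))) / ⌊(n : ℝ) ^ (σ - μ)⌋₊ ≤
      (n : ℝ) ^ ν / 4 * ⌊(n : ℝ) ^ (σ - μ)⌋₊ / (160000 * ⌊(n : ℝ) ^ (1 - μ + δ)⌋₊) / 2 := by
  set θ : ℝ := min (ν + σ - 1 - δ - (1 - τ + δ - μ)) (ν + σ - 1 - δ - (β - σ - τ + δ)) / 2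
    with hθ
  have hθ0 : 0 < θ := by
    rw [hθ]; exact half_pos (lt_min (by linarith) (by linarith))
  have hθ1 : θ < ν + σ - 1 - δ - (1 - τ + δ - μ) := by
    have := min_le_left (ν + σ - 1 - δ - (1 - τ + δ - μ)) (ν + σ - 1 - δ - (β - σ - τ + δ))
    rw [hθ]; linarith
  have hθ2 : θ < ν + σ - 1 - δ - (β - σ - τ + δ) := by
    have := min_le_right (ν + σ - 1 - δ - (1 - τ + δ - μ)) (ν + σ - 1 - δ - (β - σ - τ + δ))
    rw [hθ]; linarith
  have hlt : ν - θ < ν := by linarith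
  filter_upwards [soloAV_condE ξ hβ hμσ hτ0 ha0 (ν := ν - θ) (by linarith) (by linarith),
    soloAW_W_compare σ μ δ τ hlt] with n h ⟨_w6, hb⟩
  exact h.trans hb

/-- The comparison with Gel'fond's lower bound: eventually
`40 a (n+1)^{e₁} (n+1)^{e₂} < (n^ν/4) K/(160000 N)/2` when `e₁ + e₂ < ν + σ - 1 - δ`. -/
theorem soloAW_condH {σ ν μ δ e₁ e₂ : ℝ} (hμσ : μ < σ) (ha0 : 0 < 1 - μ + δ) (he₁ : 0 ≤ e₁)
    (he₂ : 0 ≤ e₂) (hE : e₁ + e₂ < ν + σ - 1 - δ) {a : ℝ} (ha : 0 < a) :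
    ∀ᶠ n : ℕ in atTop, 40 * a * ((n : ℝ) + 1) ^ e₁ * ((n : ℝ) + 1) ^ e₂ <
      (n : ℝ) ^ ν / 4 * ⌊(n : ℝ) ^ (σ - μ)⌋₊ / (160000 * ⌊(n : ℝ) ^ (1 - μ + δ)⌋₊) / 2 := by
  set θ : ℝ := (ν + σ - 1 - δ - (e₁ + e₂)) / 2 with hθ
  have hlt : ν - θ < ν := by rw [hθ]; linarith
  have hE' : e₁ + e₂ < ν - θ + σ - 1 - δ := by rw [hθ]; linarith
  filter_upwards [soloAV_condH (ν := ν - θ) hμσ ha0 he₁ he₂ hE' ha,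
    soloAW_W_compare σ μ δ 0 hlt] with n h ⟨_w7, hb⟩
  exact lt_of_lt_of_le h hb

end Summit.Schanuel.Schanuel.Theorems
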